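import Literature.MathematicalPhysics.QuantumFieldTheory.Balaban1983to89.Node00.SlotSandwich
import Literature.MathematicalPhysics.QuantumFieldTheory.Balaban1983to89.Node00.LiveSelectorMass
import Literature.MathematicalPhysics.QuantumFieldTheory.Balaban1983to89.Node00.DressedSlotsOfRecord12

/-!
# NODE 00 — DRESSED ∕ UNDRESSED COMPARABILITY: two slot families of the represented tower that start within positive multiples of each other and run
# through the same steps (same step weights, same selector) stay within positive multiples of each other at every level; hence they have the same zero
# sets and the same live sequences, the squeezed family inherits non-negativity ∕ bounds ∕ measurability ∕ nowhere-zero denominators, and the LIVE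
# SELECTOR OF THE FIRST FAMILY PRESERVES THE PREFIX OF EVERY MASSIVE SEQUENCE OF THE SECOND

Cell `pub-ymgap`, YM-PLAN Track A (HUMAN RULING D-0062); author seat `pub-ymgap-dag-n20-d` (g37, the N20 lineage); dag-lead g32 WORDS 286 (INTENT-7 ASSIGNED: typed KEY-BLIND over
a Stage-9-free slot recursion, to be instantiated at the CoPH selector by the consumer, per RR-2 g23 (ii)).  Companion of `Node00/SlotSandwich` (the one-step squeezes
`tstepOfRecord_sandwich ∕ rstepSlot_sandwich`), `Node00/LiveSelectorMass` (dead sequences carry no mass), def-T's regularity propagation (`Record9ProvisosOfRegularity`: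
`measurable_tstepOfRecord`, `tstepOfRecord_le_of_avgDensity_le`, displayed bound (H-h) on the marginal density of record) and `Record12MeasurabilityAnySelector.measurable_rstepSlot`.
[III] = [Balaban1988Convergent]; [IV] = [Balaban1989LargeFieldI].

WHY.  The dressed family `DressedSlotsOfRecord12.dressedSlotsOfDatum₉ ϑ D g₀ os t` (start `dressedStart = e^{t·F_K}·e^{−A∕g₀²}`, this lineage's object) and the undressed tower of
record (start `rhoZeroOfRecord = e^{−E}·e^{−A∕g₀²}`) are two instances of `texpAOfRecordFrom … start (wOfRecord₉ ϑ) (rstepSlotOfRecord … ϑ.ppSel)` with starts squeezed by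
`e^{E−|t|} ≤ e^{tF+E} ≤ e^{E+|t|}` (`|F| ≤ 1`).  The last structural inputs of hypothesis (T) of the N20 tower sockets (`Node00/DressedClassTelescoping`) for the DRESSED family at the
member of record's LIVE selector (live w.r.t. the UNDRESSED pre-𝐑 family, def-K0a's `ppSelLiveOfRecord_succ_eq`) are: non-negativity ∕ bounds ∕ measurability of the dressed
pre-𝐑 pieces, nowhere-zero denominators at selected targets, and the PIN «the selector preserves the prefix of every massive dressed sequence».  All follow from a level-wise
two-sided squeeze `m_k·slot^u_k ≤ slot^d_k ≤ M_k·slot^u_k`, `0 < m_k ≤ M_k` (§1), by positivity (§2).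

WHAT IS PROVED (generic in the numerics `ν τ`, step weights `w`, selector `ppSel`, run `p`, couplings `g`, starts `S₁, S₂`; every regularity clause a displayed hypothesis).
* §1 ★★ `sandwich_texpAOfRecordFrom`: `0 < m₀ ≤ M₀`, `m₀·S₁ ≤ S₂ ≤ M₀·S₁`, `S₂` measurable; the FIRST family non-negative, measurable and bounded at every level; `0 ≤ w`, `|w| ≤ 1`
  jointly measurable; `χ_k` measurable; (H-h) the marginal densities of record bounded ⇒ at every level `k`: the second family is measurable and `∃ 0 < m ≤ M` with
  `m·slot₁ ≤ slot₂ ≤ M·slot₁` slot-wise and pointwise (induction: `tstepOfRecord_sandwich`, then `rstepSlot_sandwich` at `ppSel p g (k+1)`).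
* §2 consequences at the PRE-𝐑 families of level `k+1` (`Tᵢ := tstepOfRecord … w p g k slotᵢ_k`): ★ `pre_sandwich` (squeeze + regularity of both), ★ `liveSeq_iff_of_sandwich`
  (same live sequences: the identity-selector 𝐑-step is squeezed too, `rstepSlot_sandwich` at `id`), ★★★ `liveSel_init_eq_or_integral_eq_zero_of_sandwich` (THE PIN: the live
  selector of the FIRST pre-𝐑 family fixes a sequence or the SECOND family's piece `χ_{k+1}(s)·T₂(s)` has zero mass — `LiveSelectorMass.integral_chi_mul_eq_zero_of_not_live`),
  ★ `fibreIntegral_ne_zero_of_sandwich` (nowhere-zero denominators transfer).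
* §3 the level-`0` squeeze of record: ★ `dressedStart_sandwich_rhoZero` (`e^{E p−|t|}·ρ₀ ≤ dressedStart ≤ e^{E p+|t|}·ρ₀` when `g 0 = g₀ p.K`, `|F| ≤ 1` by `abs_prodObs_le_one`),
  `measurable_dressedStart` (under `D.AvgMeasurable`).
* §4 at a Stage-9 tuple `ϑ` (dressed slots `dressedSlotsOfDatum₉ ϑ D g₀ os t` versus def-T's `slotsOfRecord ϑ.ν ϑ.τ9 E (wOfRecord₉ ϑ) ϑ.ppSel` — §1's two families at the starts
  `dressedStart ∕ ρ₀`, by `rfl`): ★★ `dressedSlotsOfDatum₉_sandwich_slotsOfRecord`, ★ `dressed_pre_provisos_of_slotsOfRecord` (hypotheses `hm′ ∕ h0′ ∕ hC′` of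
  `DressedClassTelescoping.sum_fiber_classWeightOfDatum₉_succ_eq` for the dressed family), ★★★ `liveSel_slotsTOfRecord_init_eq_or_integral_dressed_eq_zero` (its `hsel` at the live
  selector of the undressed pre-𝐑 family — def-K0a's `ppSelLiveOfRecord_succ_eq` names that selector), ★ `fibreIntegral_dressed_ne_zero_of_slotsOfRecord` (its `hden′` from the undressed one).

PRIOR, SUMMITS-SIDE (cited, not importable under `Literature/`; dag-lead g32 WORDS 286 ∕ 288 (3)).  The N19 lane (dag-n19-c g6) proved for F3's dressed tower the DRESSED(t) ∕
VACUUM(t = 0) domination with LEVEL-UNIFORM constants `e^{∓|t|}` at selectors DEGENERATE for the vacuum pre-𝐑 family (identity; the live re-pin):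
`Summit…BalabanUVNodesN19MGFRoadLiveSelectorTower.dressedSlotsOfDatum₉_sandwich_of_moved_not_liveSeq ∕ _of_ppSelLive`, with `tstepOfRecord_sandwich` :72 (a 𝐓-half WITHOUT
integrability ∕ (H-h), by matched junk values), `dressedStart_sandwich`, `measurable_dressedStart` :149 (RESTATED below, three lines — the only statement printing alike),
`…LiveSelectorRStep.rstepSlot_sandwich_of_moved_not_liveSeq`, `…LiveSelector.slotsOfRecord_eq_exp_mul_dressedSlotsOfDatum₉_zero ∕ liveSeq_const_mul_iff`.  What is different
here: ANY selector inside the two families (constants `(m²∕M, M²∕m)` per 𝐑-step instead of level-uniform ones), arbitrary starts, the squeeze's consequences stated as the named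
hypotheses of `Node00/DressedClassTelescoping` (pin ∕ provisos ∕ denominators), Literature-side for the N20 tower sockets.

HONEST FRAMING.  Kernel bookkeeping; the regularity of the undressed family (non-negativity, measurability, bounds — def-T's `slotsOfRecord_measurable_and_bounded` gives them at the
identity selector from (H-χ), (H-ω), (H-h)), the unity-free step-weight clauses and (H-h) are HYPOTHESES; nothing of Bałaban's asserted; no estimate; no `Provisos` inhabitant claimed;
the instantiation at the Stage-13 CoPH record (`ϑ := θ.toStage9Params`, `ppSel = ppSelLiveOfRecord …`) is the consumer's.  Counts UNMOVED (typed 28∕28 · discharged 8∕27); one finite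
four-torus programme at fixed `ε` — NOT ℝ⁴ ∕ OS ∕ mass gap ∕ Clay.  No `def`, no `sorry`, no `axiom`, no `instance`, no `notation`.
-/

noncomputable section

open MeasureTheory
open scoped BigOperators

namespace Literature.MathematicalPhysics.QuantumFieldTheory.Balaban1983to89.Node00

open T4Continuum B14.Eq218Concrete B15RopTotal T4AveragingDisintegration T4FiniteEpsInhabited
open B15.BasicStep (fibreIntegral)

variable (F : T4Family) (N : ℕ) [NeZero N]

section Generic

variable (ν : Stage7Numerics) (τ : TowerNumerics) (w : StepWeightsOfRecord F N ν τ.M) (ppSel : PpSelOfRecord F ν τ.M)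
  (S₁ S₂ : (p : B12.RunParams) → (ℕ → ℝ) → Density (F.P p.K) 0 (SU N)) (p : B12.RunParams) (g : ℕ → ℝ)

/-! ## §1 The level-wise squeeze -/

/-- ★★ **TWO FAMILIES OF THE REPRESENTED TOWER THAT START WITHIN POSITIVE MULTIPLES OF EACH OTHER STAY SO AT EVERY LEVEL.**  Families
`slotᵢ := texpAOfRecordFrom … Sᵢ w (rstepSlotOfRecord … ppSel)` (same step weights, same selector); hypotheses: `0 < m₀ ≤ M₀` with `m₀·S₁ ≤ S₂ ≤ M₀·S₁` pointwise, `S₂ p g` measurable;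
the first family non-negative, measurable and bounded at every level; `0 ≤ w ≤ 1` jointly measurable; measurable front factors; (H-h) bounded marginal densities of record.  Conclusion,
for every level `k`: every slot of the second family is measurable, and `∃ m M, 0 < m ≤ M ∧ ∀ s V, m·slot₁ k s V ≤ slot₂ k s V ≤ M·slot₁ k s V`.  Induction on `k`: the 𝐓-step keeps
`(m, M)` (`tstepOfRecord_sandwich`; the pre-𝐑 first family is bounded by (H-h), `tstepOfRecord_le_of_avgDensity_le`), the 𝐑-step at `ppSel p g (k+1)` turns it into `(m²∕M, M²∕m)`
(`rstepSlot_sandwich`). [cite: Balaban1988Convergent, (2.18) p.257, (3.1) p.264, (3.24)–(3.25) p.270; Balaban1989LargeFieldI, (0.3) p.176] -/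
theorem sandwich_texpAOfRecordFrom {m₀ M₀ : ℝ} (hm₀ : 0 < m₀) (hmM₀ : m₀ ≤ M₀)
    (hS : ∀ U, m₀ * S₁ p g U ≤ S₂ p g U ∧ S₂ p g U ≤ M₀ * S₁ p g U) (hS₂m : Measurable (S₂ p g))
    (hu0 : ∀ k s V, 0 ≤ texpAOfRecordFrom F N ν τ.M S₁ w (rstepSlotOfRecord F N ν τ ppSel) p g k s V)
    (hum : ∀ k s, Measurable (texpAOfRecordFrom F N ν τ.M S₁ w (rstepSlotOfRecord F N ν τ ppSel) p g k s))
    (huC : ∀ k, ∃ C : ℝ, ∀ s V, texpAOfRecordFrom F N ν τ.M S₁ w (rstepSlotOfRecord F N ν τ ppSel) p g k s V ≤ C)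
    (hw0 : ∀ k s' U V', 0 ≤ w p g k s' U V') (hwb : ∀ k s' U V', |w p g k s' U V'| ≤ 1)
    (hw : ∀ k s', Measurable (fun z : GaugeField (F.P p.K) (k + 1) (SU N) × GaugeField (F.P p.K) k (SU N) => w p g k s' z.2 z.1))
    (hχ : ∀ k s, Measurable (chiSeqOfRecord F N ν τ.M g p.K k s))
    (hh : ∀ k, ∃ C : ℝ, ∀ V', (avgDensity (avOfRecord F N p.K k).avg V' : ℝ) ≤ C) (k : ℕ) :
    (∀ s, Measurable (texpAOfRecordFrom F N ν τ.M S₂ w (rstepSlotOfRecord F N ν τ ppSel) p g k s)) ∧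
      ∃ m M : ℝ, 0 < m ∧ m ≤ M ∧ ∀ s V,
        m * texpAOfRecordFrom F N ν τ.M S₁ w (rstepSlotOfRecord F N ν τ ppSel) p g k s V ≤
            texpAOfRecordFrom F N ν τ.M S₂ w (rstepSlotOfRecord F N ν τ ppSel) p g k s V ∧
          texpAOfRecordFrom F N ν τ.M S₂ w (rstepSlotOfRecord F N ν τ ppSel) p g k s V ≤
            M * texpAOfRecordFrom F N ν τ.M S₁ w (rstepSlotOfRecord F N ν τ ppSel) p g k s V := by
  induction k with
  | zero => exact ⟨fun _ => hS₂m, m₀, M₀, hm₀, hmM₀, fun _ V => hS V⟩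
  | succ k ih =>
    obtain ⟨hdm, m, M, hm, hmM, hsw⟩ := ih
    have hM : 0 < M := lt_of_lt_of_le hm hmM
    obtain ⟨C, hC⟩ := huC k
    obtain ⟨Ch, hCh⟩ := hh k
    -- the recursion: `slot_{k+1} = rstepSlot … (ppSel p g (k+1)) (tstepOfRecord … k slot_k)` for both families
    have hrec : ∀ S : (p : B12.RunParams) → (ℕ → ℝ) → Density (F.P p.K) 0 (SU N),
        texpAOfRecordFrom F N ν τ.M S w (rstepSlotOfRecord F N ν τ ppSel) p g (k + 1) =
          rstepSlot F N ν τ p g (k + 1) (ppSel p g (k + 1))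
            (tstepOfRecord F N ν τ.M w p g k (texpAOfRecordFrom F N ν τ.M S w (rstepSlotOfRecord F N ν τ ppSel) p g k)) :=
      fun S => rfl
    -- the pre-𝐑 squeeze (𝐓-step) and the pre-𝐑 regularity of both families
    have hT := fun s' V' => tstepOfRecord_sandwich F N ν τ.M (hw0 k) (hwb k) (hw k) (hum k) hdm (hu0 k) hC (hχ k) hm.le hmM
      (fun s U => (hsw s U).1) (fun s U => (hsw s U).2) s' V'
    have hT0 : ∀ s' V', 0 ≤ tstepOfRecord F N ν τ.M w p g k (texpAOfRecordFrom F N ν τ.M S₁ w (rstepSlotOfRecord F N ν τ ppSel) p g k) s' V' :=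
      tstepOfRecord_nonneg F N ν τ.M (hw0 k) (hu0 k)
    have hTC : ∀ s' V', tstepOfRecord F N ν τ.M w p g k (texpAOfRecordFrom F N ν τ.M S₁ w (rstepSlotOfRecord F N ν τ ppSel) p g k) s' V' ≤ Ch * C :=
      tstepOfRecord_le_of_avgDensity_le F N ν τ.M (hwb k) (hu0 k) hC hCh
    have hTm : ∀ s', Measurable (tstepOfRecord F N ν τ.M w p g k (texpAOfRecordFrom F N ν τ.M S₁ w (rstepSlotOfRecord F N ν τ ppSel) p g k) s') :=
      fun s' => measurable_tstepOfRecord F N ν τ.M (hw k) (hum k) (hχ k) s'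
    have hTdm : ∀ s', Measurable (tstepOfRecord F N ν τ.M w p g k (texpAOfRecordFrom F N ν τ.M S₂ w (rstepSlotOfRecord F N ν τ ppSel) p g k) s') :=
      fun s' => measurable_tstepOfRecord F N ν τ.M (hw k) hdm (hχ k) s'
    refine ⟨fun s => ?_, m * m / M, M * M / m, div_pos (mul_pos hm hm) hM, ?_, fun s V => ?_⟩
    · rw [hrec S₂]
      exact measurable_rstepSlot F N ν τ (ppSel p g (k + 1)) hTdm (hχ (k + 1)) s
    · -- `m²/M ≤ M²/m`
      rw [div_le_div_iff₀ hM hm]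
      nlinarith [mul_pos hm hm, mul_pos hM hM, hmM, mul_le_mul hmM hmM hm.le hM.le]
    · rw [hrec S₁, hrec S₂]
      exact rstepSlot_sandwich F N ν τ (ppSel p g (k + 1)) hm hmM hT0 hTC hTm (hχ (k + 1))
        (fun s' V' => (hT s' V').1) (fun s' V' => (hT s' V').2) s V

/-! ## §2 Consequences at the pre-𝐑 families: regularity, live sequences, the pin, denominators -/

/-- ★ **THE PRE-𝐑 FAMILIES OF LEVEL `k+1` ARE SQUEEZED, AND THE SECOND ONE INHERITS REGULARITY** (under the hypotheses of `sandwich_texpAOfRecordFrom`): with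
`Tᵢ := tstepOfRecord … w p g k slotᵢ_k`, there are `0 < m ≤ M` with `m·T₁ ≤ T₂ ≤ M·T₁`, and `T₂` is non-negative, measurable and bounded; `T₁` likewise.
[cite: Balaban1988Convergent, (3.1) p.264, (3.24)–(3.25) p.270; Balaban1989LargeFieldI, (0.3) p.176] -/
theorem pre_sandwich {m₀ M₀ : ℝ} (hm₀ : 0 < m₀) (hmM₀ : m₀ ≤ M₀)
    (hS : ∀ U, m₀ * S₁ p g U ≤ S₂ p g U ∧ S₂ p g U ≤ M₀ * S₁ p g U) (hS₂m : Measurable (S₂ p g))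
    (hu0 : ∀ k s V, 0 ≤ texpAOfRecordFrom F N ν τ.M S₁ w (rstepSlotOfRecord F N ν τ ppSel) p g k s V)
    (hum : ∀ k s, Measurable (texpAOfRecordFrom F N ν τ.M S₁ w (rstepSlotOfRecord F N ν τ ppSel) p g k s))
    (huC : ∀ k, ∃ C : ℝ, ∀ s V, texpAOfRecordFrom F N ν τ.M S₁ w (rstepSlotOfRecord F N ν τ ppSel) p g k s V ≤ C)
    (hw0 : ∀ k s' U V', 0 ≤ w p g k s' U V') (hwb : ∀ k s' U V', |w p g k s' U V'| ≤ 1)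
    (hw : ∀ k s', Measurable (fun z : GaugeField (F.P p.K) (k + 1) (SU N) × GaugeField (F.P p.K) k (SU N) => w p g k s' z.2 z.1))
    (hχ : ∀ k s, Measurable (chiSeqOfRecord F N ν τ.M g p.K k s))
    (hh : ∀ k, ∃ C : ℝ, ∀ V', (avgDensity (avOfRecord F N p.K k).avg V' : ℝ) ≤ C) (k : ℕ) :
    (∀ s', Measurable (tstepOfRecord F N ν τ.M w p g k (texpAOfRecordFrom F N ν τ.M S₁ w (rstepSlotOfRecord F N ν τ ppSel) p g k) s')) ∧
    (∀ s', Measurable (tstepOfRecord F N ν τ.M w p g k (texpAOfRecordFrom F N ν τ.M S₂ w (rstepSlotOfRecord F N ν τ ppSel) p g k) s')) ∧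
    (∀ s' V', 0 ≤ tstepOfRecord F N ν τ.M w p g k (texpAOfRecordFrom F N ν τ.M S₁ w (rstepSlotOfRecord F N ν τ ppSel) p g k) s' V') ∧
    (∃ C : ℝ, ∀ s' V', tstepOfRecord F N ν τ.M w p g k (texpAOfRecordFrom F N ν τ.M S₁ w (rstepSlotOfRecord F N ν τ ppSel) p g k) s' V' ≤ C) ∧
    ∃ m M : ℝ, 0 < m ∧ m ≤ M ∧ ∀ s' V',
      m * tstepOfRecord F N ν τ.M w p g k (texpAOfRecordFrom F N ν τ.M S₁ w (rstepSlotOfRecord F N ν τ ppSel) p g k) s' V' ≤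
          tstepOfRecord F N ν τ.M w p g k (texpAOfRecordFrom F N ν τ.M S₂ w (rstepSlotOfRecord F N ν τ ppSel) p g k) s' V' ∧
        tstepOfRecord F N ν τ.M w p g k (texpAOfRecordFrom F N ν τ.M S₂ w (rstepSlotOfRecord F N ν τ ppSel) p g k) s' V' ≤
          M * tstepOfRecord F N ν τ.M w p g k (texpAOfRecordFrom F N ν τ.M S₁ w (rstepSlotOfRecord F N ν τ ppSel) p g k) s' V' := by
  obtain ⟨hdm, m, M, hm, hmM, hsw⟩ :=
    sandwich_texpAOfRecordFrom F N ν τ w ppSel S₁ S₂ p g hm₀ hmM₀ hS hS₂m hu0 hum huC hw0 hwb hw hχ hh k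
  obtain ⟨C, hC⟩ := huC k
  obtain ⟨Ch, hCh⟩ := hh k
  refine ⟨fun s' => measurable_tstepOfRecord F N ν τ.M (hw k) (hum k) (hχ k) s', fun s' => measurable_tstepOfRecord F N ν τ.M (hw k) hdm (hχ k) s',
    tstepOfRecord_nonneg F N ν τ.M (hw0 k) (hu0 k), ⟨Ch * C, tstepOfRecord_le_of_avgDensity_le F N ν τ.M (hwb k) (hu0 k) hC hCh⟩,
    m, M, hm, hmM, fun s' V' => ?_⟩
  exact tstepOfRecord_sandwich F N ν τ.M (hw0 k) (hwb k) (hw k) (hum k) hdm (hu0 k) hC (hχ k) hm.le hmM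
    (fun s U => (hsw s U).1) (fun s U => (hsw s U).2) s' V'

open scoped Classical in
/-- ★ **SQUEEZED SLOT FAMILIES HAVE THE SAME LIVE SEQUENCES.**  If `m·T₁ ≤ T₂ ≤ M·T₁` (`0 < m ≤ M`) with `T₁ ≥ 0` bounded measurable and measurable front factors, then a sequence is
live for `T₂` iff it is live for `T₁` (def-K0a's `LiveSeq`: the identity-selector 𝐑-step is non-zero somewhere — and it is squeezed too, `rstepSlot_sandwich` at `id`).
[cite: Balaban1989LargeFieldI, (0.3) p.176] -/
theorem liveSeq_iff_of_sandwich {k : ℕ} {T₁ T₂ : TexpASlot F N ν τ.M p g k} {m M : ℝ} (hm : 0 < m) (hmM : m ≤ M)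
    (h0 : ∀ s V, 0 ≤ T₁ s V) {C : ℝ} (hC : ∀ s V, T₁ s V ≤ C) (hT₁ : ∀ s, Measurable (T₁ s))
    (hχ : ∀ s, Measurable (chiSeqOfRecord F N ν τ.M g p.K k s))
    (hle : ∀ s V, m * T₁ s V ≤ T₂ s V) (hge : ∀ s V, T₂ s V ≤ M * T₁ s V) (s : SeqOfRecord F ν τ.M g p.K k) :
    LiveSeq F N ν τ p g k T₂ s ↔ LiveSeq F N ν τ p g k T₁ s := by
  have hM : 0 < M := lt_of_lt_of_le hm hmM
  have hsq := fun V => rstepSlot_sandwich F N ν τ id hm hmM h0 hC hT₁ hχ hle hge s V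
  have h1 : ∀ V, 0 ≤ rstepSlot F N ν τ p g k id T₁ s V := fun V => rstepSlot_nonneg F N ν τ id h0 s V
  constructor
  · rintro ⟨V, hV⟩
    refine ⟨V, fun h => hV (le_antisymm ?_ ?_)⟩
    · calc rstepSlot F N ν τ p g k id T₂ s V ≤ M * M / m * rstepSlot F N ν τ p g k id T₁ s V := (hsq V).2
        _ = 0 := by rw [h, mul_zero]
    · exact le_trans (mul_nonneg (div_pos (mul_pos hm hm) hM).le (h1 V)) (hsq V).1
  · rintro ⟨V, hV⟩
    refine ⟨V, fun h => hV (le_antisymm ?_ (h1 V))⟩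
    have := (hsq V).1
    rw [h] at this
    -- `m²/M · r₁ ≤ 0` with `m²/M > 0` forces `r₁ ≤ 0`
    exact le_of_mul_le_mul_left (by rw [mul_zero]; exact this) (div_pos (mul_pos hm hm) hM)

open scoped Classical in
/-- ★★★ **THE PIN: THE LIVE SELECTOR OF THE FIRST PRE-𝐑 FAMILY PRESERVES THE PREFIX OF EVERY MASSIVE SEQUENCE OF THE SECOND.**  Under the hypotheses of
`sandwich_texpAOfRecordFrom`, at level `k+1` with `Tᵢ := tstepOfRecord … w p g k slotᵢ_k`: for every sequence `s`,
`(liveSelOfSlot … T₁ s).init = s.init  ∨  ∫ χ_{k+1}(s)·T₂(s) dV = 0` — a live sequence of `T₁` is a fixed point of its live selector; a dead one is dead for `T₂` as well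
(`liveSeq_iff_of_sandwich`) and then carries no `T₂`-mass (`LiveSelectorMass.integral_chi_mul_eq_zero_of_not_live`, the `T₂`-piece being measurable, non-negative, bounded).
With def-K0a's `ppSelLiveOfRecord_succ_eq` this is hypothesis `hsel` of `Node00/DressedClassTelescoping` for the dressed family at the member of record's live selector.
[cite: Balaban1989LargeFieldI, (0.3)–(0.4) p.176] -/
theorem liveSel_init_eq_or_integral_eq_zero_of_sandwich {m₀ M₀ : ℝ} (hm₀ : 0 < m₀) (hmM₀ : m₀ ≤ M₀)
    (hS : ∀ U, m₀ * S₁ p g U ≤ S₂ p g U ∧ S₂ p g U ≤ M₀ * S₁ p g U) (hS₂m : Measurable (S₂ p g))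
    (hu0 : ∀ k s V, 0 ≤ texpAOfRecordFrom F N ν τ.M S₁ w (rstepSlotOfRecord F N ν τ ppSel) p g k s V)
    (hum : ∀ k s, Measurable (texpAOfRecordFrom F N ν τ.M S₁ w (rstepSlotOfRecord F N ν τ ppSel) p g k s))
    (huC : ∀ k, ∃ C : ℝ, ∀ s V, texpAOfRecordFrom F N ν τ.M S₁ w (rstepSlotOfRecord F N ν τ ppSel) p g k s V ≤ C)
    (hw0 : ∀ k s' U V', 0 ≤ w p g k s' U V') (hwb : ∀ k s' U V', |w p g k s' U V'| ≤ 1)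
    (hw : ∀ k s', Measurable (fun z : GaugeField (F.P p.K) (k + 1) (SU N) × GaugeField (F.P p.K) k (SU N) => w p g k s' z.2 z.1))
    (hχ : ∀ k s, Measurable (chiSeqOfRecord F N ν τ.M g p.K k s))
    (hh : ∀ k, ∃ C : ℝ, ∀ V', (avgDensity (avOfRecord F N p.K k).avg V' : ℝ) ≤ C) (k : ℕ)
    (s : SeqOfRecord F ν τ.M g p.K (k + 1)) :
    (liveSelOfSlot F N ν τ p g (k + 1)
        (tstepOfRecord F N ν τ.M w p g k (texpAOfRecordFrom F N ν τ.M S₁ w (rstepSlotOfRecord F N ν τ ppSel) p g k)) s).init = s.init ∨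
      ∫ V, chiSeqOfRecord F N ν τ.M g p.K (k + 1) s V *
          tstepOfRecord F N ν τ.M w p g k (texpAOfRecordFrom F N ν τ.M S₂ w (rstepSlotOfRecord F N ν τ ppSel) p g k) s V
        ∂(fieldMeasure (F.P p.K) (k + 1) (SU N)) = 0 := by
  obtain ⟨hT₁m, hT₂m, hT0, ⟨C, hC⟩, m, M, hm, hmM, hsw⟩ :=
    pre_sandwich F N ν τ w ppSel S₁ S₂ p g hm₀ hmM₀ hS hS₂m hu0 hum huC hw0 hwb hw hχ hh k
  have hM : 0 < M := lt_of_lt_of_le hm hmM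
  by_cases hs : LiveSeq F N ν τ p g (k + 1)
      (tstepOfRecord F N ν τ.M w p g k (texpAOfRecordFrom F N ν τ.M S₁ w (rstepSlotOfRecord F N ν τ ppSel) p g k)) s
  · exact Or.inl (by rw [liveSelOfSlot_of_live F N hs])
  · right
    have hs₂ : ¬ LiveSeq F N ν τ p g (k + 1)
        (tstepOfRecord F N ν τ.M w p g k (texpAOfRecordFrom F N ν τ.M S₂ w (rstepSlotOfRecord F N ν τ ppSel) p g k)) s :=
      fun h => hs ((liveSeq_iff_of_sandwich F N ν τ p g hm hmM hT0 hC hT₁m (hχ (k + 1))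
        (fun s V => (hsw s V).1) (fun s V => (hsw s V).2) s).1 h)
    -- the `T₂`-piece is measurable, non-negative, bounded
    have hC0 : 0 ≤ C := by
      obtain ⟨V₀⟩ : Nonempty (GaugeField (F.P p.K) (k + 1) (SU N)) := ⟨fun _ => 1⟩
      exact (hT0 s V₀).trans (hC s V₀)
    refine integral_chi_mul_eq_zero_of_not_live F N ν τ p g (k + 1) _ s ((hχ (k + 1) s).mul (hT₂m s))
      (fun V => mul_nonneg (chiSeqOfRecord_nonneg F N ν τ.M g p.K (k + 1) s V) (le_trans (mul_nonneg hm.le (hT0 s V)) (hsw s V).1))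
      (C := M * C) (fun V => ?_) hs₂
    calc chiSeqOfRecord F N ν τ.M g p.K (k + 1) s V * _ ≤ 1 * (M * C) :=
          mul_le_mul (chiSeqOfRecord_le_one F N ν τ.M g p.K (k + 1) s V) ((hsw s V).2.trans (mul_le_mul_of_nonneg_left (hC s V) hM.le))
            (le_trans (mul_nonneg hm.le (hT0 s V)) (hsw s V).1) zero_le_one
      _ = M * C := one_mul _

open scoped Classical in
/-- ★ **NOWHERE-ZERO DENOMINATORS TRANSFER**: under a squeeze `m·T₁ ≤ T₂ ≤ M·T₁` (`0 < m ≤ M`, `T₁ ≥ 0` bounded measurable, `χ_k` measurable), a fibre integral of a `T₁`-piece that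
vanishes nowhere is matched by the `T₂`-piece (`m·∫⌈t₁ ≤ ∫⌈t₂`, `SlotSandwich.fibreIntegral_sandwich`).  The bond-decidability instance is implicit (unified from the consumer's
denominator statement). [cite: Balaban1989LargeFieldI, (0.3) p.176 (proviso «denominators are positive»)] -/
theorem fibreIntegral_ne_zero_of_sandwich {k : ℕ} {iP : DecidableEq (PBond (F.P p.K) k)} {T₁ T₂ : TexpASlot F N ν τ.M p g k} {m M : ℝ}
    (hm : 0 < m) (hmM : m ≤ M) (h0 : ∀ s V, 0 ≤ T₁ s V) {C : ℝ} (hC : ∀ s V, T₁ s V ≤ C) (hT₁ : ∀ s, Measurable (T₁ s))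
    (hχ : ∀ s, Measurable (chiSeqOfRecord F N ν τ.M g p.K k s))
    (hle : ∀ s V, m * T₁ s V ≤ T₂ s V) (hge : ∀ s V, T₂ s V ≤ M * T₁ s V)
    (Z : Finset (PBond (F.P p.K) k)) (a : SeqOfRecord F ν τ.M g p.K k) (V : GaugeField (F.P p.K) k (SU N))
    (hden : fibreIntegral Z (fun U => chiSeqOfRecord F N ν τ.M g p.K k a U * T₁ a U) V ≠ 0) :
    fibreIntegral Z (fun U => chiSeqOfRecord F N ν τ.M g p.K k a U * T₂ a U) V ≠ 0 := by
  have hM : 0 ≤ M := hm.le.trans hmM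
  have htC : ∀ U, chiSeqOfRecord F N ν τ.M g p.K k a U * T₁ a U ≤ C := fun U =>
    (mul_le_mul (chiSeqOfRecord_le_one F N ν τ.M g p.K k a U) (hC a U) (h0 a U) zero_le_one).trans (by rw [one_mul])
  have hl : ∀ U, m * (chiSeqOfRecord F N ν τ.M g p.K k a U * T₁ a U) ≤ chiSeqOfRecord F N ν τ.M g p.K k a U * T₂ a U := fun U => by
    rw [mul_left_comm]; exact mul_le_mul_of_nonneg_left (hle a U) (chiSeqOfRecord_nonneg F N ν τ.M g p.K k a U)
  have hu : ∀ U, chiSeqOfRecord F N ν τ.M g p.K k a U * T₂ a U ≤ M * (chiSeqOfRecord F N ν τ.M g p.K k a U * T₁ a U) := fun U => by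
    rw [mul_left_comm]; exact mul_le_mul_of_nonneg_left (hge a U) (chiSeqOfRecord_nonneg F N ν τ.M g p.K k a U)
  have h := (fibreIntegral_sandwich (iP := iP) Z htC ((hχ a).mul (hT₁ a)) hm.le hM hl hu V).1
  intro h2
  rw [h2] at h
  have hpos : 0 < fibreIntegral Z (fun U => chiSeqOfRecord F N ν τ.M g p.K k a U * T₁ a U) V :=
    lt_of_le_of_ne (fibreIntegral_nonneg' _ _ _) (Ne.symm hden)
  exact absurd h (not_le.2 (mul_pos hm hpos))

end Generic

/-! ## §3 The level-`0` squeeze of record: dressed start versus `ρ₀` -/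

/-- ★ **THE DRESSED START IS WITHIN POSITIVE MULTIPLES OF `ρ₀`**: when the run's history starts at the dressing's coupling (`g 0 = g₀ p.K`),
`e^{E p − |t|}·ρ₀(U) ≤ dressedStart D g₀ os t p (U) ≤ e^{E p + |t|}·ρ₀(U)` for every `U`, with `ρ₀ = rhoZeroOfRecord F N p.K (g 0) (E p) = e^{−E p}·e^{−A∕g₀²}` and
`dressedStart = e^{t·F_K}·e^{−A∕g₀²}`, `|F_K| ≤ 1` (`T4GenFunBounds.abs_prodObs_le_one`). [cite: Balaban1988Convergent, Thm 1 p.262 (`ρ₀`); King1986, (3.10) p.656 (dressed partition functions; bookkeeping)] -/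
theorem dressedStart_sandwich_rhoZero (D : FiniteEpsData F (SU N)) (g₀ : ℕ → ℝ) (os : List (ULoop F)) (t : ℝ) (E : B12.RunParams → ℝ)
    (p : B12.RunParams) (g : ℕ → ℝ) (hg : g 0 = g₀ p.K) (U : GaugeField (F.P p.K) 0 (SU N)) :
    Real.exp (E p - |t|) * rhoZeroOfRecord F N p.K (g 0) (E p) U ≤ dressedStart F N D g₀ os t p U ∧
      dressedStart F N D g₀ os t p U ≤ Real.exp (E p + |t|) * rhoZeroOfRecord F N p.K (g 0) (E p) U := by
  have hF : |T4GenFunBounds.prodObs (D.scheme g₀) p.K os U| ≤ 1 :=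
    T4GenFunBounds.abs_prodObs_le_one (D.scheme g₀) (fun K o U => D.abs_avgObs_le_one K o U) p.K os U
  have hB : 0 ≤ Missing.boltzmann (F.P p.K) ((g₀ p.K)⁻¹ ^ 2) U := (Missing.boltzmann_pos _ _ _).le
  have ht1 : -|t| ≤ t * T4GenFunBounds.prodObs (D.scheme g₀) p.K os U := by
    have := neg_abs_le (t * T4GenFunBounds.prodObs (D.scheme g₀) p.K os U)
    rw [abs_mul] at this
    nlinarith [abs_nonneg t, hF, abs_nonneg (T4GenFunBounds.prodObs (D.scheme g₀) p.K os U)]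
  have ht2 : t * T4GenFunBounds.prodObs (D.scheme g₀) p.K os U ≤ |t| := by
    have := le_abs_self (t * T4GenFunBounds.prodObs (D.scheme g₀) p.K os U)
    rw [abs_mul] at this
    nlinarith [abs_nonneg t, hF, abs_nonneg (T4GenFunBounds.prodObs (D.scheme g₀) p.K os U)]
  show Real.exp (E p - |t|) * (Real.exp (-E p) * Missing.boltzmann (F.P p.K) ((g 0)⁻¹ ^ 2) U) ≤
      Real.exp (t * T4GenFunBounds.prodObs (D.scheme g₀) p.K os U) * Missing.boltzmann (F.P p.K) ((g₀ p.K)⁻¹ ^ 2) U ∧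
    Real.exp (t * T4GenFunBounds.prodObs (D.scheme g₀) p.K os U) * Missing.boltzmann (F.P p.K) ((g₀ p.K)⁻¹ ^ 2) U ≤
      Real.exp (E p + |t|) * (Real.exp (-E p) * Missing.boltzmann (F.P p.K) ((g 0)⁻¹ ^ 2) U)
  rw [hg, ← mul_assoc, ← mul_assoc, ← Real.exp_add, ← Real.exp_add]
  constructor
  · refine mul_le_mul_of_nonneg_right (Real.exp_le_exp.2 ?_) hB
    linarith
  · refine mul_le_mul_of_nonneg_right (Real.exp_le_exp.2 ?_) hB
    linarith

/-- The dressed start is measurable when the datum's averaging maps are (`D.AvgMeasurable`, true of printed-averaged data): `e^{t·F_K}` measurable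
(`T4GenFunBounds.measurable_prodObs`), the Wilson–Boltzmann weight measurable (`Missing.measurable_boltzmann`).  RESTATEMENT (same statement, same three-line proof) of the
Summits-side `Summit.QuantumFields.YangMills.BalabanUVNodes.N19MGFRoadLiveSelectorTower.measurable_dressedStart` (dag-n19-c), which a `Literature/` module cannot import.
[cite: King1986, (3.10) p.656 (dressed partition functions; bookkeeping)] -/
theorem measurable_dressedStart (D : FiniteEpsData F (SU N)) (hM : D.AvgMeasurable) (g₀ : ℕ → ℝ) (os : List (ULoop F)) (t : ℝ) (p : B12.RunParams) :
    Measurable (dressedStart F N D g₀ os t p) := by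
  have hF : Measurable (T4GenFunBounds.prodObs (D.scheme g₀) p.K os) :=
    T4GenFunBounds.measurable_prodObs (D.scheme g₀) (fun K o => D.measurable_avgObs hM K o) p.K os
  show Measurable (fun U => Real.exp (t * T4GenFunBounds.prodObs (D.scheme g₀) p.K os U) * Missing.boltzmann (F.P p.K) ((g₀ p.K)⁻¹ ^ 2) U)
  exact (Real.measurable_exp.comp (hF.const_mul t)).mul (Missing.measurable_boltzmann RegularGaugeGroup.measurable_reTr (F.P p.K) _)

/-! ## §4 At a Stage-9 tuple: the dressed slots of a datum versus def-T's undressed tower of record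

`dressedSlotsOfDatum₉ ϑ D g₀ os t` and `slotsOfRecord ϑ.ν ϑ.τ9 E (wOfRecord₉ ϑ) ϑ.ppSel` ARE the two families of §1 at the starts `dressedStart` ∕ `ρ₀` (both `rfl`:
`texpAOfRecordFrom_rhoZero`), so §§1–3 specialise by name.  The undressed regularity (non-negativity, measurability, bounds at every level), the step-weight clauses
(`0 ≤ wOfRecord₉ ≤ 1`, jointly measurable — `wOfRecord_nonneg`, `abs_wOfRecord_le_one`, `measurable_wOfRecord` under (H-ζ), (H-ω)), the front-factor measurability ((H-χ)) and (H-h) stay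
DISPLAYED hypotheses; `hg : g 0 = g₀ p.K` says the history starts at the dressing's coupling (true of the histories of record). -/

section Record

variable (ϑ : Stage9Params F N) (D : FiniteEpsData F (SU N)) (g₀ : ℕ → ℝ) (os : List (ULoop F)) (t : ℝ) (E : B12.RunParams → ℝ)
  (p : B12.RunParams) (g : ℕ → ℝ)

/-- ★★ **THE DRESSED SLOTS OF A DATUM ARE WITHIN POSITIVE MULTIPLES OF THE UNDRESSED SLOTS OF RECORD, LEVEL BY LEVEL** (and measurable): §1's
`sandwich_texpAOfRecordFrom` at the starts `ρ₀ ∕ dressedStart` (`dressedStart_sandwich_rhoZero`, `measurable_dressedStart`).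
[cite: Balaban1988Convergent, (2.18) p.257, (3.24)–(3.25) p.270; Balaban1989LargeFieldI, (0.3) p.176; King1986, (3.10) p.656 (bookkeeping)] -/
theorem dressedSlotsOfDatum₉_sandwich_slotsOfRecord (hM : D.AvgMeasurable) (hg : g 0 = g₀ p.K)
    (hu0 : ∀ k s V, 0 ≤ slotsOfRecord F N ϑ.ν ϑ.τ9 E (wOfRecord₉ F N ϑ) ϑ.ppSel p g k s V)
    (hum : ∀ k s, Measurable (slotsOfRecord F N ϑ.ν ϑ.τ9 E (wOfRecord₉ F N ϑ) ϑ.ppSel p g k s))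
    (huC : ∀ k, ∃ C : ℝ, ∀ s V, slotsOfRecord F N ϑ.ν ϑ.τ9 E (wOfRecord₉ F N ϑ) ϑ.ppSel p g k s V ≤ C)
    (hw0 : ∀ k s' U V', 0 ≤ wOfRecord₉ F N ϑ p g k s' U V') (hwb : ∀ k s' U V', |wOfRecord₉ F N ϑ p g k s' U V'| ≤ 1)
    (hw : ∀ k s', Measurable (fun z : GaugeField (F.P p.K) (k + 1) (SU N) × GaugeField (F.P p.K) k (SU N) => wOfRecord₉ F N ϑ p g k s' z.2 z.1))
    (hχ : ∀ k s, Measurable (chiSeqOfRecord F N ϑ.ν ϑ.τ9.M g p.K k s))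
    (hh : ∀ k, ∃ C : ℝ, ∀ V', (avgDensity (avOfRecord F N p.K k).avg V' : ℝ) ≤ C) (k : ℕ) :
    (∀ s, Measurable (dressedSlotsOfDatum₉ F N ϑ D g₀ os t p g k s)) ∧
      ∃ m M : ℝ, 0 < m ∧ m ≤ M ∧ ∀ s V,
        m * slotsOfRecord F N ϑ.ν ϑ.τ9 E (wOfRecord₉ F N ϑ) ϑ.ppSel p g k s V ≤ dressedSlotsOfDatum₉ F N ϑ D g₀ os t p g k s V ∧
          dressedSlotsOfDatum₉ F N ϑ D g₀ os t p g k s V ≤ M * slotsOfRecord F N ϑ.ν ϑ.τ9 E (wOfRecord₉ F N ϑ) ϑ.ppSel p g k s V :=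
  sandwich_texpAOfRecordFrom F N ϑ.ν ϑ.τ9 (wOfRecord₉ F N ϑ) ϑ.ppSel (fun p g => rhoZeroOfRecord F N p.K (g 0) (E p))
    (fun p _ => dressedStart F N D g₀ os t p) p g (Real.exp_pos _) (Real.exp_le_exp.2 (by linarith [abs_nonneg t]))
    (fun U => dressedStart_sandwich_rhoZero F N D g₀ os t E p g hg U) (measurable_dressedStart F N D hM g₀ os t p) hu0 hum huC hw0 hwb hw hχ hh k

/-- ★ **THE (0.3) PROVISOS ON THE PRE-𝐑 DRESSED FAMILY, FROM THE UNDRESSED ONES**: at level `k+1` the dressed pieces `χ_{k+1}(s′)·(𝐓-step dressed_k)(s′)` are measurable,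
non-negative and bounded — hypotheses `hm′ ∕ h0′ ∕ hC′` of `Node00/DressedClassTelescoping.sum_fiber_classWeightOfDatum₉_succ_eq` (`pre_sandwich`; `0 ≤ χ ≤ 1`).
[cite: Balaban1989LargeFieldI, (0.3) p.176 (provisos); Balaban1988Convergent, (3.24)–(3.25) p.270] -/
theorem dressed_pre_provisos_of_slotsOfRecord (hM : D.AvgMeasurable) (hg : g 0 = g₀ p.K)
    (hu0 : ∀ k s V, 0 ≤ slotsOfRecord F N ϑ.ν ϑ.τ9 E (wOfRecord₉ F N ϑ) ϑ.ppSel p g k s V)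
    (hum : ∀ k s, Measurable (slotsOfRecord F N ϑ.ν ϑ.τ9 E (wOfRecord₉ F N ϑ) ϑ.ppSel p g k s))
    (huC : ∀ k, ∃ C : ℝ, ∀ s V, slotsOfRecord F N ϑ.ν ϑ.τ9 E (wOfRecord₉ F N ϑ) ϑ.ppSel p g k s V ≤ C)
    (hw0 : ∀ k s' U V', 0 ≤ wOfRecord₉ F N ϑ p g k s' U V') (hwb : ∀ k s' U V', |wOfRecord₉ F N ϑ p g k s' U V'| ≤ 1)
    (hw : ∀ k s', Measurable (fun z : GaugeField (F.P p.K) (k + 1) (SU N) × GaugeField (F.P p.K) k (SU N) => wOfRecord₉ F N ϑ p g k s' z.2 z.1))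
    (hχ : ∀ k s, Measurable (chiSeqOfRecord F N ϑ.ν ϑ.τ9.M g p.K k s))
    (hh : ∀ k, ∃ C : ℝ, ∀ V', (avgDensity (avOfRecord F N p.K k).avg V' : ℝ) ≤ C) (k : ℕ) :
    (∀ s', Measurable (fun V => chiSeqOfRecord F N ϑ.ν ϑ.τ9.M g p.K (k + 1) s' V *
      tstepOfRecord F N ϑ.ν ϑ.τ9.M (wOfRecord₉ F N ϑ) p g k (dressedSlotsOfDatum₉ F N ϑ D g₀ os t p g k) s' V)) ∧
    (∀ s' V, 0 ≤ chiSeqOfRecord F N ϑ.ν ϑ.τ9.M g p.K (k + 1) s' V *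
      tstepOfRecord F N ϑ.ν ϑ.τ9.M (wOfRecord₉ F N ϑ) p g k (dressedSlotsOfDatum₉ F N ϑ D g₀ os t p g k) s' V) ∧
    ∃ C : ℝ, ∀ s' V, chiSeqOfRecord F N ϑ.ν ϑ.τ9.M g p.K (k + 1) s' V *
      tstepOfRecord F N ϑ.ν ϑ.τ9.M (wOfRecord₉ F N ϑ) p g k (dressedSlotsOfDatum₉ F N ϑ D g₀ os t p g k) s' V ≤ C := by
  obtain ⟨-, hT₂m, hT0, ⟨C, hC⟩, m, M, hm, hmM, hsw⟩ :=
    pre_sandwich F N ϑ.ν ϑ.τ9 (wOfRecord₉ F N ϑ) ϑ.ppSel (fun p g => rhoZeroOfRecord F N p.K (g 0) (E p))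
      (fun p _ => dressedStart F N D g₀ os t p) p g (Real.exp_pos _) (Real.exp_le_exp.2 (by linarith [abs_nonneg t]))
      (fun U => dressedStart_sandwich_rhoZero F N D g₀ os t E p g hg U) (measurable_dressedStart F N D hM g₀ os t p) hu0 hum huC hw0 hwb hw hχ hh k
  have hM0 : 0 ≤ M := hm.le.trans hmM
  have hd0 : ∀ s' V, 0 ≤ tstepOfRecord F N ϑ.ν ϑ.τ9.M (wOfRecord₉ F N ϑ) p g k (dressedSlotsOfDatum₉ F N ϑ D g₀ os t p g k) s' V :=
    fun s' V => le_trans (mul_nonneg hm.le (hT0 s' V)) (hsw s' V).1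
  refine ⟨fun s' => (hχ (k + 1) s').mul (hT₂m s'), fun s' V => mul_nonneg (chiSeqOfRecord_nonneg F N ϑ.ν ϑ.τ9.M g p.K (k + 1) s' V) (hd0 s' V),
    M * C, fun s' V => ?_⟩
  calc chiSeqOfRecord F N ϑ.ν ϑ.τ9.M g p.K (k + 1) s' V * _ ≤ 1 * (M * C) :=
        mul_le_mul (chiSeqOfRecord_le_one F N ϑ.ν ϑ.τ9.M g p.K (k + 1) s' V) ((hsw s' V).2.trans (mul_le_mul_of_nonneg_left (hC s' V) hM0))
          (hd0 s' V) zero_le_one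
    _ = M * C := one_mul _

open scoped Classical in
/-- ★★★ **THE PIN AT A STAGE-9 TUPLE: the live selector of def-T's UNDRESSED pre-𝐑 family of record preserves the prefix of every massive DRESSED pre-𝐑 sequence.**
For every level `k` and sequence `s′` of length `k+1`: `(liveSelOfSlot … (slotsTOfRecord … ϑ.ppSel p g (k+1)) s′).init = s′.init ∨ ∫ χ_{k+1}(s′)·(𝐓-step dressed_k)(s′) = 0`
(`liveSel_init_eq_or_integral_eq_zero_of_sandwich`; `slotsTOfRecord_succ`).  When `ϑ.ppSel` is the live selector of record, def-K0a's `ppSelLiveOfRecord_succ_eq` rewrites the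
selector here into `ϑ.ppSel p g (k+1)` — hypothesis `hsel` of `Node00/DressedClassTelescoping.sum_fiber_classWeightOfDatum₉_succ_eq` for the dressed family (the consumer's step).
[cite: Balaban1989LargeFieldI, (0.3)–(0.4) p.176; Balaban1988Convergent, (3.22)–(3.25) pp.269–270] -/
theorem liveSel_slotsTOfRecord_init_eq_or_integral_dressed_eq_zero (hM : D.AvgMeasurable) (hg : g 0 = g₀ p.K)
    (hu0 : ∀ k s V, 0 ≤ slotsOfRecord F N ϑ.ν ϑ.τ9 E (wOfRecord₉ F N ϑ) ϑ.ppSel p g k s V)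
    (hum : ∀ k s, Measurable (slotsOfRecord F N ϑ.ν ϑ.τ9 E (wOfRecord₉ F N ϑ) ϑ.ppSel p g k s))
    (huC : ∀ k, ∃ C : ℝ, ∀ s V, slotsOfRecord F N ϑ.ν ϑ.τ9 E (wOfRecord₉ F N ϑ) ϑ.ppSel p g k s V ≤ C)
    (hw0 : ∀ k s' U V', 0 ≤ wOfRecord₉ F N ϑ p g k s' U V') (hwb : ∀ k s' U V', |wOfRecord₉ F N ϑ p g k s' U V'| ≤ 1)
    (hw : ∀ k s', Measurable (fun z : GaugeField (F.P p.K) (k + 1) (SU N) × GaugeField (F.P p.K) k (SU N) => wOfRecord₉ F N ϑ p g k s' z.2 z.1))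
    (hχ : ∀ k s, Measurable (chiSeqOfRecord F N ϑ.ν ϑ.τ9.M g p.K k s))
    (hh : ∀ k, ∃ C : ℝ, ∀ V', (avgDensity (avOfRecord F N p.K k).avg V' : ℝ) ≤ C) (k : ℕ) (s' : SeqOfRecord F ϑ.ν ϑ.τ9.M g p.K (k + 1)) :
    (liveSelOfSlot F N ϑ.ν ϑ.τ9 p g (k + 1) (slotsTOfRecord F N ϑ.ν ϑ.τ9 E (wOfRecord₉ F N ϑ) ϑ.ppSel p g (k + 1)) s').init = s'.init ∨
      ∫ V, chiSeqOfRecord F N ϑ.ν ϑ.τ9.M g p.K (k + 1) s' V *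
          tstepOfRecord F N ϑ.ν ϑ.τ9.M (wOfRecord₉ F N ϑ) p g k (dressedSlotsOfDatum₉ F N ϑ D g₀ os t p g k) s' V
        ∂(fieldMeasure (F.P p.K) (k + 1) (SU N)) = 0 :=
  liveSel_init_eq_or_integral_eq_zero_of_sandwich F N ϑ.ν ϑ.τ9 (wOfRecord₉ F N ϑ) ϑ.ppSel (fun p g => rhoZeroOfRecord F N p.K (g 0) (E p))
    (fun p _ => dressedStart F N D g₀ os t p) p g (Real.exp_pos _) (Real.exp_le_exp.2 (by linarith [abs_nonneg t]))
    (fun U => dressedStart_sandwich_rhoZero F N D g₀ os t E p g hg U) (measurable_dressedStart F N D hM g₀ os t p) hu0 hum huC hw0 hwb hw hχ hh k s'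

/-- ★ **NOWHERE-ZERO DENOMINATORS TRANSFER FROM THE UNDRESSED TO THE DRESSED PRE-𝐑 FAMILY**: at level `k+1`, over any bond set `Z`, at any point `a` and field `V`, a non-vanishing
restricted integral of the undressed piece `χ_{k+1}(a)·(𝐓-step undressed_k)(a)` forces the dressed one not to vanish (`fibreIntegral_ne_zero_of_sandwich`, `pre_sandwich`) — hypothesis
`hden′` of `Node00/DressedClassTelescoping.sum_fiber_classWeightOfDatum₉_succ_eq` for the dressed family from def-R's (0.3) proviso on the undressed one (`Z := fibOfSeq … s′`,
`a := ϑ.ppSel p g (k+1) s′`).  The bond-decidability instance is implicit (the consumer's). [cite: Balaban1989LargeFieldI, (0.3) p.176 (proviso «denominators are positive»)] -/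
theorem fibreIntegral_dressed_ne_zero_of_slotsOfRecord (hM : D.AvgMeasurable) (hg : g 0 = g₀ p.K)
    (hu0 : ∀ k s V, 0 ≤ slotsOfRecord F N ϑ.ν ϑ.τ9 E (wOfRecord₉ F N ϑ) ϑ.ppSel p g k s V)
    (hum : ∀ k s, Measurable (slotsOfRecord F N ϑ.ν ϑ.τ9 E (wOfRecord₉ F N ϑ) ϑ.ppSel p g k s))
    (huC : ∀ k, ∃ C : ℝ, ∀ s V, slotsOfRecord F N ϑ.ν ϑ.τ9 E (wOfRecord₉ F N ϑ) ϑ.ppSel p g k s V ≤ C)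
    (hw0 : ∀ k s' U V', 0 ≤ wOfRecord₉ F N ϑ p g k s' U V') (hwb : ∀ k s' U V', |wOfRecord₉ F N ϑ p g k s' U V'| ≤ 1)
    (hw : ∀ k s', Measurable (fun z : GaugeField (F.P p.K) (k + 1) (SU N) × GaugeField (F.P p.K) k (SU N) => wOfRecord₉ F N ϑ p g k s' z.2 z.1))
    (hχ : ∀ k s, Measurable (chiSeqOfRecord F N ϑ.ν ϑ.τ9.M g p.K k s))
    (hh : ∀ k, ∃ C : ℝ, ∀ V', (avgDensity (avOfRecord F N p.K k).avg V' : ℝ) ≤ C) (k : ℕ) {iP : DecidableEq (PBond (F.P p.K) (k + 1))}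
    (Z : Finset (PBond (F.P p.K) (k + 1))) (a : SeqOfRecord F ϑ.ν ϑ.τ9.M g p.K (k + 1)) (V : GaugeField (F.P p.K) (k + 1) (SU N))
    (hden : fibreIntegral Z (fun U => chiSeqOfRecord F N ϑ.ν ϑ.τ9.M g p.K (k + 1) a U *
      tstepOfRecord F N ϑ.ν ϑ.τ9.M (wOfRecord₉ F N ϑ) p g k (slotsOfRecord F N ϑ.ν ϑ.τ9 E (wOfRecord₉ F N ϑ) ϑ.ppSel p g k) a U) V ≠ 0) :
    fibreIntegral Z (fun U => chiSeqOfRecord F N ϑ.ν ϑ.τ9.M g p.K (k + 1) a U *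
      tstepOfRecord F N ϑ.ν ϑ.τ9.M (wOfRecord₉ F N ϑ) p g k (dressedSlotsOfDatum₉ F N ϑ D g₀ os t p g k) a U) V ≠ 0 := by
  obtain ⟨hT₁m, -, hT0, ⟨C, hC⟩, m, M, hm, hmM, hsw⟩ :=
    pre_sandwich F N ϑ.ν ϑ.τ9 (wOfRecord₉ F N ϑ) ϑ.ppSel (fun p g => rhoZeroOfRecord F N p.K (g 0) (E p))
      (fun p _ => dressedStart F N D g₀ os t p) p g (Real.exp_pos _) (Real.exp_le_exp.2 (by linarith [abs_nonneg t]))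
      (fun U => dressedStart_sandwich_rhoZero F N D g₀ os t E p g hg U) (measurable_dressedStart F N D hM g₀ os t p) hu0 hum huC hw0 hwb hw hχ hh k
  exact fibreIntegral_ne_zero_of_sandwich F N ϑ.ν ϑ.τ9 p g (iP := iP) hm hmM hT0 hC hT₁m (hχ (k + 1))
    (fun s V => (hsw s V).1) (fun s V => (hsw s V).2) Z a V hden

end Record

end Literature.MathematicalPhysics.QuantumFieldTheory.Balaban1983to89.Node00

end
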